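import Mathlib
import HarnessLib
import Summits.HubbardSuperconductivity.HubbardSuperconductivity.Theorems.KLProgrammeKLRegimeEngineV8ExportUnroll
import Summits.HubbardSuperconductivity.HubbardSuperconductivity.Theorems.KLProgrammeKLRegimeEngineV8TwoLegMomentsExportGrid

/-!
# Skeleton v2 of `KLRegimeEngineV17F2` (stmt-HubbardSuperconductivity-20437): the (R59w) GRID BOOTSTRAP — comparison history ⇒ public history ⇒ grid atom,
# at every comparison volume and every scale (cell gate-hubbard-kl, seat p1b g11 — 20437 registrant lineage)

Context.  In the v2 engine-flow skeleton (render input of record `engine-flow-v2x.dryrun-r4pC-Yprime.lean`, plan g19 (R59w)/(R59ae)), stub (e) `stub_twoLeg_step`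
at `(L, M, n)` reads the two-leg GRID atom `TwoLegGridMomentsAt L₁ M₁ Zt Zs β U μ (K_{n'}(L₁, M₁)) n'` (…EngineV8TwoLegMomentsExportGrid, p557865) at EVERY scale
`n' ≤ n` and EVERY comparison volume `(L₁, M₁)` above `(L; Q.M0)`, under that volume's COMPARISON history
`∀ j < n', histV17F2 L₁ M₁ G P Q R β U μ j ∧ TwoLegSlopes L₁ M₁ R β U μ (K_j(L₁, M₁)) j` — the antecedent currency of `TwoLegVolumeRateF`, which is all the
(e) closer ever holds at a comparison volume (rows C1/C2's packagings `spLeg_/cutLeg_allScales_of_gridMoments_V17F2_*`, p559934/p560490, carry exactly this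
`hh₁` binder).  The only PRODUCER of the atom — stub (b)'s fourth conjunct `TwoLegGridFlowMomentsAt L M Zt Zs β U μ n` — is keyed to the PUBLIC history
`HistP klPredsV17F2 L M G P Q R β U μ 0 n`, which is STRICTLY STRONGER (`histP_klPredsV17F2_iff`: it also holds `TwoLegStepV17F2 j ⊇ TwoLegVolumeRateF j` at
every `j < n`).  The gap is closed by a BOOTSTRAP, by strong induction on the scale over all comparison volumes: the missing two-leg slots below `m` at a
comparison volume are the scale-0 two-leg stub (M) / the two-leg stub (e) at the lower scales AT THAT VOLUME, whose own grid inputs are the bootstrap one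
scale down.  This module proves the bootstrap ONCE, generically in the stub-shaped hypotheses (so the v2 composition applies it to the registered stubs and
every later render inherits it):

* §1 **`compHist_of_histP`** — the public history restricts to the comparison history (with slopes) of the same volume.
* §2 **`gridBootstrap_of_stubShapes`** — for fixed outer data `(G, P, Q, R, c, μ, U, β)` and a base volume size `L`, abstract per-volume/per-scale data
  `J` (stub (C)'s reading-jet bound), `Lev` (stub (b)'s levels bundle), `LevU` (the class-#1 merged exports), budgets `(Zt, Zs)`, and the five stub SHAPES as
  hypotheses — (C): `HistP → FrameOK → EngineBoundsAtV17F2 → J`; (M): `FrameOK (K_0) → EngineBoundsAtV17F2 0 → J 0 → TwoLegStepV17F2 0`; class #1: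
  `HistP → LevU`; (b): `HistP → FrameOK → LevU → Lev ∧ TwoLegGridFlowMomentsAt`; the scale-0 grid atom; (e): `HistP → FrameOK → EngineBoundsAtV17F2 → J → Lev →
  LevU → (grid binder, comparison-keyed, scales ≤ n, volumes ≥ its own) → TwoLegStepV17F2` — conclude: **at every `m ≤ n_β + 1` and every `(L₁, M₁)` with
  `L ≤ L₁`, `Q.M0 β L₁ ≤ M₁`, the comparison history below `m` implies `HistP … 0 m ∧ TwoLegGridMomentsAt L₁ M₁ Zt Zs β U μ (K_m(L₁, M₁)) m`.**
* §3 **`gridBinder_of_stubShapes`** — the corollary in stub (e)'s binder shape at the base volume: `∀ n' ≤ n, ∀ (L₁ M₁), L ≤ L₁ → Q.M0 β L₁ ≤ M₁ →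
  (comparison history below n') → TwoLegGridMomentsAt L₁ M₁ Zt Zs β U μ (K_{n'}(L₁, M₁)) n'`; and **`twoLegGridFlowMomentsAt_of_gridBinder`** — the engine's own
  `TwoLegGridFlowMomentsAt L M Zt Zs β U μ n` back from such a binder and its public history (the (e) closer's row B).

Proofs only (pure bookkeeping over the slot vocabulary of …SplitSlotsV17F2); no definitions; nothing here asserts that any stub holds; nothing asserts the K3
theorem half or superconductivity.  References: BGM 2006 §2.4 (2.23), (2.36) [cite: BenfattoGiulianiMastropietro2006].
-/

noncomputable section

namespace Summit.HubbardSuperconductivity.HubbardSuperconductivity.Theorems.EngineV8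

set_option linter.dupNamespace false -- summit = problem name (single-conjunct summit), D-0017

open Real Finset Literature.MathematicalPhysics.QuantumLattice Literature.Probability.LatticeModels
open Literature.MathematicalPhysics.QuantumLattice.FermiRG
open Summit.HubbardSuperconductivity.HubbardSuperconductivity.Theorems.KLProgrammeLegKernels
open Summit.HubbardSuperconductivity.HubbardSuperconductivity.Theorems.DispersionFlow
open Summit.HubbardSuperconductivity.HubbardSuperconductivity.Theorems.KLRegimeSplit

/-! ## §1 Public history ⇒ comparison history -/

section CompHist

variable {L M : ℕ} [NeZero L] [NeZero M] {G : GeoConsts} {P : SplitConsts} {Q : EngConsts} {R : RenConsts} {β U μ : ℝ} {K : TrigPolyC4v}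

/-- **The public history of a volume restricts to its comparison history (with slopes)**: `HistP klPredsV17F2 L M … K n` gives, at every `j < n`,
`histV17F2 L M … j` (split ∧ renorm ∧ engine ∧ reading jets) AND `TwoLegSlopes L M R β U μ (K_j) j` (the second conjunct of the two-leg slot). -/
theorem compHist_of_histP {n : ℕ} (h : HistP klPredsV17F2 L M G P Q R β U μ K n) :
    ∀ j < n, histV17F2 L M G P Q R β U μ j ∧ TwoLegSlopes L M R β U μ (klFlowFrameU L M β U μ j) j :=
  fun j hj => ⟨histV17F2_of_histP h j hj, (h j hj).2.2.2.2.1⟩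

/-- Conversely, **the comparison history plus the two-leg slots below `n` IS the public history** (`histP_klPredsV17F2_iff`). -/
theorem histP_of_compHist_of_twoLeg {n : ℕ}
    (hC : ∀ j < n, histV17F2 L M G P Q R β U μ j ∧ TwoLegSlopes L M R β U μ (klFlowFrameU L M β U μ j) j)
    (hT : ∀ j < n, TwoLegStepV17F2 L M G P Q R β U μ j) : HistP klPredsV17F2 L M G P Q R β U μ K n :=
  (histP_klPredsV17F2_iff L M G P Q R β U μ K n).2 fun j hj => ⟨(hC j hj).1.1, (hC j hj).1.2.1, (hC j hj).1.2.2.1, hT j hj⟩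

end CompHist

/-! ## §2 The bootstrap, generic in the stub shapes -/

section Bootstrap

variable (G : GeoConsts) (P : SplitConsts) (Q : EngConsts) (R : RenConsts) (β U μ c : ℝ) (L : ℕ)
variable (J Lev LevU : (L' M' : ℕ) → [NeZero L'] → [NeZero M'] → ℕ → Prop) (Zt Zs : ℝ)

/-- **THE (R59w) GRID BOOTSTRAP, generic in the stub shapes.**  Outer data fixed; `hQM0 : klEngM₃ β U ≤ Q.M0 β` (an `rfl` row for the token packages);
`R.WF2`, the bare frame's admissibility `h0`, the regime numerals (`0 ≤ c`, `klBetaMin ≤ β ≤ e^{c/U²}`) for `IsKLRegime` at every scale `≤ n_β + 1`.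
Stub-shaped hypotheses, each quantified over the comparison volumes `(L₁, M₁)` with `L ≤ L₁`, `klEngM₃ β U L₁ ≤ M₁`:
`hC` = stub (C) (reading jets from the public history, the frame and the engine bounds), `hM` = stub (M) (the scale-0 two-leg slot), `hLevU` = the class-#1
unroll (merged exports from the public history), `hb` = stub (b)'s levels bundle and grid conjunct, `h0g` = the scale-0 grid atom (a theorem in the render:
`twoLegGridFlowMomentsAt_zero_klE3A1` ∘ allowance), `he` = stub (e) with its (R59w) grid binder (comparison-keyed, scales `≤ n`, volumes `≥ L₁`).
CONCLUSION: at every scale `m ≤ n_β + 1` and every comparison volume above `(L; Q.M0)`, the comparison history below `m` yields the PUBLIC history below `m`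
and the grid atom at `m`. -/
theorem gridBootstrap_of_stubShapes (hQM0 : ∀ L' : ℕ, klEngM₃ β U L' ≤ Q.M0 β L') (hR : R.WF2) (h0 : FrameOK R U (nScales β) μ 0)
    (hc : 0 ≤ c) (hβ : klBetaMin ≤ β) (hβc : β ≤ Real.exp (c / U ^ 2))
    (hC : ∀ (L₁ M₁ : ℕ) [NeZero L₁] [NeZero M₁], L ≤ L₁ → klEngM₃ β U L₁ ≤ M₁ → ∀ n ≤ nScales β + 1, IsKLRegime U c (-(n : ℤ)) →
      HistP klPredsV17F2 L₁ M₁ G P Q R β U μ 0 n → FrameOK R U (nScales β) μ (klFlowFrameU L₁ M₁ β U μ n) →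
        EngineBoundsAtV17F2 L₁ M₁ G P Q β U μ n → J L₁ M₁ n)
    (hM : ∀ (L₁ M₁ : ℕ) [NeZero L₁] [NeZero M₁], L ≤ L₁ → klEngM₃ β U L₁ ≤ M₁ →
      FrameOK R U (nScales β) μ (klFlowFrameU L₁ M₁ β U μ 0) → EngineBoundsAtV17F2 L₁ M₁ G P Q β U μ 0 → J L₁ M₁ 0 →
        TwoLegStepV17F2 L₁ M₁ G P Q R β U μ 0)
    (hLevU : ∀ (L₁ M₁ : ℕ) [NeZero L₁] [NeZero M₁], L ≤ L₁ → klEngM₃ β U L₁ ≤ M₁ → ∀ n ≤ nScales β + 1,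
      HistP klPredsV17F2 L₁ M₁ G P Q R β U μ 0 n → LevU L₁ M₁ n)
    (hb : ∀ (L₁ M₁ : ℕ) [NeZero L₁] [NeZero M₁], L ≤ L₁ → klEngM₃ β U L₁ ≤ M₁ → ∀ n, 1 ≤ n → n ≤ nScales β + 1 → IsKLRegime U c (-(n : ℤ)) →
      HistP klPredsV17F2 L₁ M₁ G P Q R β U μ 0 n → FrameOK R U (nScales β) μ (klFlowFrameU L₁ M₁ β U μ n) → LevU L₁ M₁ n →
        Lev L₁ M₁ n ∧ TwoLegGridFlowMomentsAt L₁ M₁ Zt Zs β U μ n)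
    (h0g : ∀ (L₁ M₁ : ℕ) [NeZero L₁] [NeZero M₁], L ≤ L₁ → klEngM₃ β U L₁ ≤ M₁ → TwoLegGridFlowMomentsAt L₁ M₁ Zt Zs β U μ 0)
    (he : ∀ (L₁ M₁ : ℕ) [NeZero L₁] [NeZero M₁], L ≤ L₁ → klEngM₃ β U L₁ ≤ M₁ → ∀ n, 1 ≤ n → n ≤ nScales β + 1 → IsKLRegime U c (-(n : ℤ)) →
      HistP klPredsV17F2 L₁ M₁ G P Q R β U μ 0 n → FrameOK R U (nScales β) μ (klFlowFrameU L₁ M₁ β U μ n) →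
        EngineBoundsAtV17F2 L₁ M₁ G P Q β U μ n → J L₁ M₁ n → Lev L₁ M₁ n → LevU L₁ M₁ n →
          (∀ n' ≤ n, ∀ (L₂ M₂ : ℕ) [NeZero L₂] [NeZero M₂], L₁ ≤ L₂ → Q.M0 β L₂ ≤ M₂ →
            (∀ j < n', histV17F2 L₂ M₂ G P Q R β U μ j ∧ TwoLegSlopes L₂ M₂ R β U μ (klFlowFrameU L₂ M₂ β U μ j) j) →
              TwoLegGridMomentsAt L₂ M₂ Zt Zs β U μ (klFlowFrameU L₂ M₂ β U μ n') n') →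
          TwoLegStepV17F2 L₁ M₁ G P Q R β U μ n) :
    ∀ m ≤ nScales β + 1, ∀ (L₁ M₁ : ℕ) [NeZero L₁] [NeZero M₁], L ≤ L₁ → Q.M0 β L₁ ≤ M₁ →
      (∀ j < m, histV17F2 L₁ M₁ G P Q R β U μ j ∧ TwoLegSlopes L₁ M₁ R β U μ (klFlowFrameU L₁ M₁ β U μ j) j) →
        HistP klPredsV17F2 L₁ M₁ G P Q R β U μ 0 m ∧ TwoLegGridMomentsAt L₁ M₁ Zt Zs β U μ (klFlowFrameU L₁ M₁ β U μ m) m := by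
  intro m
  induction m using Nat.strong_induction_on with
  | _ m ih =>
    intro hm L₁ M₁ _ _ hLL₁ hM₁ hCH
    have hM₁' : klEngM₃ β U L₁ ≤ M₁ := (hQM0 L₁).trans hM₁
    -- (i) the public history below `m` at `(L₁, M₁)`: the two-leg slots below `m` are (M) / (e) at that volume
    have hhist : HistP klPredsV17F2 L₁ M₁ G P Q R β U μ 0 m := by
      refine histP_of_compHist_of_twoLeg hCH fun i hi => ?_
      have him : i ≤ nScales β + 1 := (le_of_lt hi).trans hm
      have hCHi : ∀ j < i, histV17F2 L₁ M₁ G P Q R β U μ j ∧ TwoLegSlopes L₁ M₁ R β U μ (klFlowFrameU L₁ M₁ β U μ j) j :=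
        fun j hj => hCH j (hj.trans hi)
      have hhistI : HistP klPredsV17F2 L₁ M₁ G P Q R β U μ 0 i := (ih i hi him L₁ M₁ hLL₁ hM₁ hCHi).1
      have hfrI : FrameOK R U (nScales β) μ (klFlowFrameU L₁ M₁ β U μ i) := frameOK_klFlowFrameU_of_histP hR h0 him hhistI
      have hregI : IsKLRegime U c (-(i : ℤ)) := isKLRegime_of_le_nScales_succ hc hβ hβc him
      have hEI : EngineBoundsAtV17F2 L₁ M₁ G P Q β U μ i := (hCH i hi).1.2.2.1
      have hJI : J L₁ M₁ i := hC L₁ M₁ hLL₁ hM₁' i him hregI hhistI hfrI hEI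
      rcases Nat.eq_zero_or_pos i with rfl | hi1
      · exact hM L₁ M₁ hLL₁ hM₁' hfrI hEI hJI
      · have hLU : LevU L₁ M₁ i := hLevU L₁ M₁ hLL₁ hM₁' i him hhistI
        have hLv : Lev L₁ M₁ i := (hb L₁ M₁ hLL₁ hM₁' i hi1 him hregI hhistI hfrI hLU).1
        exact he L₁ M₁ hLL₁ hM₁' i hi1 him hregI hhistI hfrI hEI hJI hLv hLU
          (fun i' hi' L₂ M₂ _ _ hL₁L₂ hM₂ hCH₂ => (ih i' (lt_of_le_of_lt hi' hi) (hi'.trans him) L₂ M₂ (hLL₁.trans hL₁L₂) hM₂ hCH₂).2)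
    refine ⟨hhist, ?_⟩
    -- (ii) the grid atom at `(L₁, M₁, m)`: the scale-0 atom / (b)ₘ's grid conjunct at that volume
    rcases Nat.eq_zero_or_pos m with rfl | hm1
    · exact (twoLegGridFlowMomentsAt_iff Zt Zs β U μ 0).1 (h0g L₁ M₁ hLL₁ hM₁')
    · have hfr : FrameOK R U (nScales β) μ (klFlowFrameU L₁ M₁ β U μ m) := frameOK_klFlowFrameU_of_histP hR h0 hm hhist
      exact (twoLegGridFlowMomentsAt_iff Zt Zs β U μ m).1
        (hb L₁ M₁ hLL₁ hM₁' m hm1 hm (isKLRegime_of_le_nScales_succ hc hβ hβc hm) hhist hfr (hLevU L₁ M₁ hLL₁ hM₁' m hm hhist)).2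

/-! ## §3 The corollaries in stub (e)'s binder shape -/

/-- **Stub (e)'s (R59w) grid binder at the base volume, from the bootstrap**: at every scale `n' ≤ n ≤ n_β + 1` and every comparison volume above
`(L; Q.M0)`, the comparison history below `n'` gives the grid atom at `n'` (the second half of `gridBootstrap_of_stubShapes`). -/
theorem gridBinder_of_stubShapes (hQM0 : ∀ L' : ℕ, klEngM₃ β U L' ≤ Q.M0 β L') (hR : R.WF2) (h0 : FrameOK R U (nScales β) μ 0)
    (hc : 0 ≤ c) (hβ : klBetaMin ≤ β) (hβc : β ≤ Real.exp (c / U ^ 2))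
    (hC : ∀ (L₁ M₁ : ℕ) [NeZero L₁] [NeZero M₁], L ≤ L₁ → klEngM₃ β U L₁ ≤ M₁ → ∀ n ≤ nScales β + 1, IsKLRegime U c (-(n : ℤ)) →
      HistP klPredsV17F2 L₁ M₁ G P Q R β U μ 0 n → FrameOK R U (nScales β) μ (klFlowFrameU L₁ M₁ β U μ n) →
        EngineBoundsAtV17F2 L₁ M₁ G P Q β U μ n → J L₁ M₁ n)
    (hM : ∀ (L₁ M₁ : ℕ) [NeZero L₁] [NeZero M₁], L ≤ L₁ → klEngM₃ β U L₁ ≤ M₁ →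
      FrameOK R U (nScales β) μ (klFlowFrameU L₁ M₁ β U μ 0) → EngineBoundsAtV17F2 L₁ M₁ G P Q β U μ 0 → J L₁ M₁ 0 →
        TwoLegStepV17F2 L₁ M₁ G P Q R β U μ 0)
    (hLevU : ∀ (L₁ M₁ : ℕ) [NeZero L₁] [NeZero M₁], L ≤ L₁ → klEngM₃ β U L₁ ≤ M₁ → ∀ n ≤ nScales β + 1,
      HistP klPredsV17F2 L₁ M₁ G P Q R β U μ 0 n → LevU L₁ M₁ n)
    (hb : ∀ (L₁ M₁ : ℕ) [NeZero L₁] [NeZero M₁], L ≤ L₁ → klEngM₃ β U L₁ ≤ M₁ → ∀ n, 1 ≤ n → n ≤ nScales β + 1 → IsKLRegime U c (-(n : ℤ)) →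
      HistP klPredsV17F2 L₁ M₁ G P Q R β U μ 0 n → FrameOK R U (nScales β) μ (klFlowFrameU L₁ M₁ β U μ n) → LevU L₁ M₁ n →
        Lev L₁ M₁ n ∧ TwoLegGridFlowMomentsAt L₁ M₁ Zt Zs β U μ n)
    (h0g : ∀ (L₁ M₁ : ℕ) [NeZero L₁] [NeZero M₁], L ≤ L₁ → klEngM₃ β U L₁ ≤ M₁ → TwoLegGridFlowMomentsAt L₁ M₁ Zt Zs β U μ 0)
    (he : ∀ (L₁ M₁ : ℕ) [NeZero L₁] [NeZero M₁], L ≤ L₁ → klEngM₃ β U L₁ ≤ M₁ → ∀ n, 1 ≤ n → n ≤ nScales β + 1 → IsKLRegime U c (-(n : ℤ)) →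
      HistP klPredsV17F2 L₁ M₁ G P Q R β U μ 0 n → FrameOK R U (nScales β) μ (klFlowFrameU L₁ M₁ β U μ n) →
        EngineBoundsAtV17F2 L₁ M₁ G P Q β U μ n → J L₁ M₁ n → Lev L₁ M₁ n → LevU L₁ M₁ n →
          (∀ n' ≤ n, ∀ (L₂ M₂ : ℕ) [NeZero L₂] [NeZero M₂], L₁ ≤ L₂ → Q.M0 β L₂ ≤ M₂ →
            (∀ j < n', histV17F2 L₂ M₂ G P Q R β U μ j ∧ TwoLegSlopes L₂ M₂ R β U μ (klFlowFrameU L₂ M₂ β U μ j) j) →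
              TwoLegGridMomentsAt L₂ M₂ Zt Zs β U μ (klFlowFrameU L₂ M₂ β U μ n') n') →
          TwoLegStepV17F2 L₁ M₁ G P Q R β U μ n)
    {n : ℕ} (hn : n ≤ nScales β + 1) :
    ∀ n' ≤ n, ∀ (L₁ M₁ : ℕ) [NeZero L₁] [NeZero M₁], L ≤ L₁ → Q.M0 β L₁ ≤ M₁ →
      (∀ j < n', histV17F2 L₁ M₁ G P Q R β U μ j ∧ TwoLegSlopes L₁ M₁ R β U μ (klFlowFrameU L₁ M₁ β U μ j) j) →
        TwoLegGridMomentsAt L₁ M₁ Zt Zs β U μ (klFlowFrameU L₁ M₁ β U μ n') n' :=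
  fun n' hn' L₁ M₁ _ _ hLL₁ hM₁ hCH =>
    (gridBootstrap_of_stubShapes G P Q R β U μ c L J Lev LevU Zt Zs hQM0 hR h0 hc hβ hβc hC hM hLevU hb h0g he n' (hn'.trans hn) L₁ M₁ hLL₁ hM₁ hCH).2

end Bootstrap

section RowB

variable {L M : ℕ} [NeZero L] [NeZero M] {G : GeoConsts} {P : SplitConsts} {Q : EngConsts} {R : RenConsts} {β U μ : ℝ} {K : TrigPolyC4v}

/-- **Row B of the (e) closer from the (R59w) binder**: the engine's own grid export `TwoLegGridFlowMomentsAt L M Zt Zs β U μ n` is the binder's instance at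
`(n, L, M)`, fed with the comparison history of the engine's own public history (`compHist_of_histP`); threshold row `hQM0` as above. -/
theorem twoLegGridFlowMomentsAt_of_gridBinder (hQM0 : ∀ L' : ℕ, Q.M0 β L' ≤ klEngM₃ β U L') {Zt Zs : ℝ} {n : ℕ}
    (hGs : ∀ n' ≤ n, ∀ (L₁ M₁ : ℕ) [NeZero L₁] [NeZero M₁], L ≤ L₁ → Q.M0 β L₁ ≤ M₁ →
      (∀ j < n', histV17F2 L₁ M₁ G P Q R β U μ j ∧ TwoLegSlopes L₁ M₁ R β U μ (klFlowFrameU L₁ M₁ β U μ j) j) →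
        TwoLegGridMomentsAt L₁ M₁ Zt Zs β U μ (klFlowFrameU L₁ M₁ β U μ n') n')
    (hM : klEngM₃ β U L ≤ M) (hhist : HistP klPredsV17F2 L M G P Q R β U μ K n) : TwoLegGridFlowMomentsAt L M Zt Zs β U μ n :=
  (twoLegGridFlowMomentsAt_iff Zt Zs β U μ n).2 (hGs n le_rfl L M le_rfl ((hQM0 L).trans hM) (compHist_of_histP hhist))

end RowB

end Summit.HubbardSuperconductivity.HubbardSuperconductivity.Theorems.EngineV8

end
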